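import Mathlib
import Literature.Combinatorics.Additive.TripleProductProperty

/-!
# `SnSubsetDichotomy.ThresholdSubsetTriples`, line `SketchIdeator2` — stub `stub_tpp_of_twistFree`, certificate form

Crux `stmt-MatrixMultiplication-10882` (`Summit.MatrixMultiplication.MatrixMultiplication.Theses.SnSubsetDichotomy.
ThresholdSubsetTriples`), line `SketchIdeator2` (ℤ/3-triality: triples `(X, τXτ⁻¹, τ²Xτ⁻²)` with `τ³ = 1`),
registered stub `stub_tpp_of_twistFree` (the *triality lever*): if `τ³ = 1` in `S_n` and the finite set
`X ⊆ S_n` has only trivial *twisted corners* — `x₁x₁'⁻¹ τ (x₂x₂'⁻¹) τ (x₃x₃'⁻¹) τ = 1` forces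
`xᵢ = xᵢ'` — then `(X, τXτ⁻¹, τ²Xτ⁻²)` has the triple product property
(`Literature.Combinatorics.Additive.TripleProductProperty`, Cohn–Umans 2003, Def. 2.1).

This file proves the stub through its FINITE CORE, which is a *word identity*: in ANY group, for any
seven elements `s s' b b' c c' τ`,

`s s'⁻¹ · τ · (b b'⁻¹) · τ · (c c'⁻¹) · τ
   = (s s'⁻¹ · (τbτ⁻¹)(τb'τ⁻¹)⁻¹ · (τ²cτ⁻²)(τ²c'τ⁻²)⁻¹) · τ³`            (★)

(no relation on `τ` is needed for (★) itself).  A word identity holds in every group iff it holds in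
the free group, where equality is DECIDABLE (Mathlib's `FreeGroup.reduce` computes maximal reductions;
`DecidableEq (FreeGroup α)`).  So:

* `core_decide` — (★) in the free group `FreeGroup (Fin 7)` on the letters
  `0 ↦ s, 1 ↦ s', 2 ↦ b, 3 ↦ b', 4 ↦ c, 5 ↦ c', 6 ↦ τ`, proved by `decide`: the kernel reduces both
  words (9 and 21 letters as written) to the same reduced 9-letter word — that computation is the
  certificate;
* `core` — (★) in an arbitrary group, by applying the universal property `FreeGroup.lift` to
  `core_decide` (a monoid homomorphism maps the certified identity to the identity of the images);
* `stub_tpp_of_twistFree` — the registered signature: a TPP relation of the twisted triple with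
  `t = τbτ⁻¹, t' = τb'τ⁻¹, u = τ²cτ⁻², u' = τ²c'τ⁻²` is, by (★) and `τ³ = 1`, a twisted corner of `X`,
  hence trivial, and `b = b'`, `c = c'` give `t = t'`, `u = u'`.

An independent proof of the same registered signature by the `group` normaliser is
`Summit.MatrixMultiplication.MatrixMultiplication.Theorems.ThresholdSubsetTriples.stub_tpp_of_twistFree`
(file `SnSubsetDichotomyThresholdSubsetTriplesStubTppOfTwistFree.lean`); this file lives in the
sub-namespace `TppOfTwistFreeK4` and imports nothing from it.  Deliberately NOT here: anything about the
host design (`stub_blockedHosts`), the deletion step or the volume bookkeeping — other stubs of the line.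
-/

namespace Summit.MatrixMultiplication.MatrixMultiplication.Theorems.ThresholdSubsetTriples.TppOfTwistFreeK4

open Literature.Combinatorics.Additive

/-- **Finite core, certified.**  The word identity (★) in the free group on seven letters
`x₀ … x₆` (read `x₀ = s, x₁ = s', x₂ = b, x₃ = b', x₄ = c, x₅ = c', x₆ = τ`):
`x₀x₁⁻¹ x₆ (x₂x₃⁻¹) x₆ (x₄x₅⁻¹) x₆ = (x₀x₁⁻¹ · (x₆x₂x₆⁻¹)(x₆x₃x₆⁻¹)⁻¹ · (x₆²x₄x₆⁻²)(x₆²x₅x₆⁻²)⁻¹) · x₆³`.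
Proved by `decide`: equality in `FreeGroup (Fin 7)` is decided by comparing maximal reductions
(`FreeGroup.toWord`), and the kernel carries out that reduction. [folklore] -/
theorem core_decide :
    (FreeGroup.of 0 * (FreeGroup.of 1)⁻¹ * FreeGroup.of 6 * (FreeGroup.of 2 * (FreeGroup.of 3)⁻¹) *
        FreeGroup.of 6 * (FreeGroup.of 4 * (FreeGroup.of 5)⁻¹) * FreeGroup.of 6 : FreeGroup (Fin 7)) =
      FreeGroup.of 0 * (FreeGroup.of 1)⁻¹ *
        (FreeGroup.of 6 * FreeGroup.of 2 * (FreeGroup.of 6)⁻¹ *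
          (FreeGroup.of 6 * FreeGroup.of 3 * (FreeGroup.of 6)⁻¹)⁻¹) *
        (FreeGroup.of 6 ^ 2 * FreeGroup.of 4 * (FreeGroup.of 6 ^ 2)⁻¹ *
          (FreeGroup.of 6 ^ 2 * FreeGroup.of 5 * (FreeGroup.of 6 ^ 2)⁻¹)⁻¹) *
        FreeGroup.of 6 ^ 3 := by
  decide

/-- **Finite core, transported to an arbitrary group** by the universal property of the free group:
for all `s s' b b' c c' τ` in a group `G`,
`s s'⁻¹ τ (b b'⁻¹) τ (c c'⁻¹) τ = (s s'⁻¹ · (τbτ⁻¹)(τb'τ⁻¹)⁻¹ · (τ²cτ⁻²)(τ²c'τ⁻²)⁻¹) · τ³`.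
Obtained by applying the homomorphism `FreeGroup.lift ![s, s', b, b', c, c', τ]` to `core_decide`.
[folklore] -/
theorem core {G : Type*} [Group G] (s s' b b' c c' τ : G) :
    s * s'⁻¹ * τ * (b * b'⁻¹) * τ * (c * c'⁻¹) * τ =
      s * s'⁻¹ * (τ * b * τ⁻¹ * (τ * b' * τ⁻¹)⁻¹) *
        (τ ^ 2 * c * (τ ^ 2)⁻¹ * (τ ^ 2 * c' * (τ ^ 2)⁻¹)⁻¹) * τ ^ 3 := by
  have h := congrArg (FreeGroup.lift ![s, s', b, b', c, c', τ]) core_decide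
  simpa only [map_mul, map_inv, map_pow, FreeGroup.lift_apply_of, Matrix.cons_val_zero,
    Matrix.cons_val_one, Matrix.cons_val] using h

/-- **Stub `stub_tpp_of_twistFree` — the triality lever** (registered stub of line `SketchIdeator2`,
crux `SnSubsetDichotomy.ThresholdSubsetTriples`, stmt-MatrixMultiplication-10882; certificate form).
If `τ³ = 1` in `S_n` and every twisted corner `x₁x₁'⁻¹ τ (x₂x₂'⁻¹) τ (x₃x₃'⁻¹) τ = 1` of the finite set
`X ⊆ S_n` is trivial, then `(X, τXτ⁻¹, τ²Xτ⁻²)` has the triple product property.  Proof: write the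
middle and right factors of a TPP relation as conjugates of `b, b', c, c' ∈ X`; by the certified word
identity `core` and `τ³ = 1` the relation is a twisted corner of `X`, hence `s = s'`, `b = b'`,
`c = c'`. [folklore] -/
theorem stub_tpp_of_twistFree : ∀ (n : ℕ) (τ : Equiv.Perm (Fin n)) (X : Finset (Equiv.Perm (Fin n))), τ ^ 3 = 1 → (∀ x₁ ∈ X, ∀ x₁' ∈ X, ∀ x₂ ∈ X, ∀ x₂' ∈ X, ∀ x₃ ∈ X, ∀ x₃' ∈ X, x₁ * x₁'⁻¹ * τ * (x₂ * x₂'⁻¹) * τ * (x₃ * x₃'⁻¹) * τ = 1 → x₁ = x₁' ∧ x₂ = x₂' ∧ x₃ = x₃') → TripleProductProperty X (X.image (fun x => τ * x * τ⁻¹)) (X.image (fun x => τ ^ 2 * x * (τ ^ 2)⁻¹)) := by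
  intro n τ X hτ htw s hs s' hs' t ht t' ht' u hu u' hu' hprod
  obtain ⟨b, hb, rfl⟩ := Finset.mem_image.mp ht
  obtain ⟨b', hb', rfl⟩ := Finset.mem_image.mp ht'
  obtain ⟨c, hc, rfl⟩ := Finset.mem_image.mp hu
  obtain ⟨c', hc', rfl⟩ := Finset.mem_image.mp hu'
  -- the TPP relation is a twisted corner of `X`: certified identity `core`, then `τ³ = 1`
  have key : s * s'⁻¹ * τ * (b * b'⁻¹) * τ * (c * c'⁻¹) * τ = 1 := by
    rw [core, hprod, hτ, one_mul]
  obtain ⟨h1, h2, h3⟩ := htw s hs s' hs' b hb b' hb' c hc c' hc' key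
  subst h1 h2 h3
  exact ⟨rfl, rfl, rfl⟩

end Summit.MatrixMultiplication.MatrixMultiplication.Theorems.ThresholdSubsetTriples.TppOfTwistFreeK4
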